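import Summits.CriticalPhenomena.PercolationContinuityZ3.Theses.PercNonProliferation
import Literature.Probability.Percolation.SlabCriticality
import Literature.Probability.Percolation.HalfSpacePinnedPairs
import Literature.Probability.Percolation.SubgraphMonotonicity

/-!
# Candidate proof of `stub_slabTransfer` of the line `slab-ladder-two-curtains`
# (crux stmt-CriticalPhenomena-4446, `SubpolynomialBlocking`)

Evidence file (planner, crux-plan): discharges the KNOWN stub 1 of
`Cruxes/SubpolynomialBlocking/Lines/slab-ladder-two-curtains.lean`,

  `∀ p n, P_p^{ℤ³}(curtain0 n) = P_p^{S_{4n}}((slabCross (4n) n)ᶜ)`,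

with the SAME definitions of `curtain0`, `slabCross`, `μ`, `μS` as the skeleton (copied verbatim below,
in the sub-namespace `TransferProof` so that nothing clashes). A prover may paste the section
`## The proof` into the skeleton in place of the `sorry` of `stub_slabTransfer` and propose it
`--supports stmt-CriticalPhenomena-4446` (the skeleton keeps the stub registered until then).

Route of the proof: (1) the restriction coupling `P_p^{ℤ³} ∘ (restrictConfig val)⁻¹ = P_p^{S_k}`
(`bondPercolation_map_comap`) and an exact correspondence of restricted open connections
(`restrictConfig_mem_openConnIn_iff`, a graph isomorphism between the two induced open graphs)
identify `P^{S_{4n}}((slabCross)ᶜ)` with the `ℤ³`-probability of the OFFSET curtain (region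
`{0 ≤ x₀ ≤ 4n} × [-2n,2n]²`); (2) the shift by `2n·e₀` carries the centred curtain onto the offset
one (`relabel_mem_openConnIn_iff`) and preserves `P_p` (`bondPercolation_real_preimage_shift`).
-/

noncomputable section

open MeasureTheory Filter Topology
open Literature.Probability.Percolation Literature.Probability.LatticeModels

namespace Summit.CriticalPhenomena.PercolationContinuityZ3.Cruxes.SubpolynomialBlocking.SlabLadderTwoCurtains.TransferProof

/-! ## Copies of the skeleton's definitions -/

abbrev μ (p : unitInterval) : Measure (BondConfig (Site 3)) := bondPercolation (zdGraph 3) p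

abbrev μS (k : ℕ) (p : unitInterval) : Measure (BondConfig (slab 3 k)) :=
  bondPercolation (slabGraph 3 k) p

def column0 (n : ℕ) : Set (Site 3) :=
  {v | v ∈ box 3 (2 * n) ∧ |v 1| ≤ (n : ℤ) ∧ |v 2| ≤ (n : ℤ)}

def lateral0 (n : ℕ) : Set (Site 3) :=
  {v | v ∈ box 3 (2 * n) ∧ (|v 1| = 2 * (n : ℤ) ∨ |v 2| = 2 * (n : ℤ))}

def curtain0 (n : ℕ) : Set (BondConfig (Site 3)) :=
  {ω | ¬ ∃ x ∈ column0 n, ∃ y ∈ lateral0 n, ω ∈ openConnIn ↑(box 3 (2 * n)) x y}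

def slabCross (k n : ℕ) : Set (BondConfig (slab 3 k)) :=
  slabConn k (sqBox (0 : ℤ × ℤ) (2 * n)) (sqBox (0 : ℤ × ℤ) n) (sqSphere (0 : ℤ × ℤ) (2 * n))

theorem measurableSet_slabCross (k n : ℕ) : MeasurableSet (slabCross k n) :=
  measurableSet_slabConn k _ _ _ _

/-! ## The proof -/

/-! ### (1) Restricted open connections under the restriction coupling -/

section Restrict

variable {V : Type*}

/-- The graph isomorphism between the open graph of the restricted configuration induced on
`S ⊆ T` and the open graph of `ω` induced on `val '' S ⊆ V`. -/
def restrictIso (T : Set V) (ω : BondConfig V) (S : Set T) :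
    ((openGraph (restrictConfig (Subtype.val : T → V) ω)).induce S) ≃g
      ((openGraph ω).induce (Subtype.val '' S)) where
  toEquiv := Equiv.Set.image (Subtype.val : T → V) S Subtype.val_injective
  map_rel_iff' := by
    intro a b
    simp only [SimpleGraph.comap_adj, Function.Embedding.coe_subtype, openGraph_adj,
      Equiv.Set.image_apply, mem_restrictConfig, Sym2.map_mk, ne_eq]
    rw [Subtype.val_injective.eq_iff]

/-- **Restriction correspondence**: `restrictConfig val ω ∈ {x̃ ↔ ỹ in S}` iff
`ω ∈ {x ↔ y in val '' S}` — an open path of the slab configuration inside `S` is an open path of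
`ω` inside the image region and conversely (both are walks in isomorphic induced open graphs). -/
theorem restrictConfig_mem_openConnIn_iff (T : Set V) (ω : BondConfig V) (S : Set T) (x y : T) :
    restrictConfig (Subtype.val : T → V) ω ∈ openConnIn S x y ↔
      ω ∈ openConnIn (Subtype.val '' S) x.1 y.1 := by
  constructor
  · rintro ⟨hx, hy, h⟩
    exact ⟨⟨x, hx, rfl⟩, ⟨y, hy, rfl⟩,
      (SimpleGraph.Iso.reachable_iff (φ := restrictIso T ω S) (u := ⟨x, hx⟩) (v := ⟨y, hy⟩)).2 h⟩
  · rintro ⟨hx', hy', h⟩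
    obtain ⟨a, ha, hav⟩ := hx'
    obtain ⟨b, hb, hbv⟩ := hy'
    have hx : x ∈ S := by rwa [← Subtype.val_injective hav]
    have hy : y ∈ S := by rwa [← Subtype.val_injective hbv]
    exact ⟨hx, hy,
      (SimpleGraph.Iso.reachable_iff (φ := restrictIso T ω S) (u := ⟨x, hx⟩) (v := ⟨y, hy⟩)).1 h⟩

end Restrict

/-! ### The offset objects (the slab frame `{0 ≤ x₀ ≤ 4n}`) -/

/-- The offset region `{0 ≤ x₀ ≤ 4n} × [-2n,2n]²` = image of the lift of `B_{2n}`. -/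
def regionOff (n : ℕ) : Set (Site 3) :=
  Subtype.val '' slabLift (4 * n) (sqBox (0 : ℤ × ℤ) (2 * n))

/-- The offset column = image of the lift of `B_n`. -/
def columnOff (n : ℕ) : Set (Site 3) :=
  Subtype.val '' slabLift (4 * n) (sqBox (0 : ℤ × ℤ) n)

/-- The offset lateral boundary = image of the lift of `∂B_{2n}`. -/
def lateralOff (n : ℕ) : Set (Site 3) :=
  Subtype.val '' slabLift (4 * n) (sqSphere (0 : ℤ × ℤ) (2 * n))

/-- The offset curtain. -/
def curtainOff (n : ℕ) : Set (BondConfig (Site 3)) :=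
  {ω | ¬ ∃ x ∈ columnOff n, ∃ y ∈ lateralOff n, ω ∈ openConnIn (regionOff n) x y}

/-- Membership in the image of a lift. -/
theorem mem_image_val_slabLift_iff (k : ℕ) (E : Set (ℤ × ℤ)) (z : Site 3) :
    z ∈ Subtype.val '' slabLift k E ↔ (0 ≤ z 0 ∧ z 0 ≤ (k : ℤ)) ∧ (z 1, z 2) ∈ E := by
  constructor
  · rintro ⟨a, ha, rfl⟩
    exact ⟨a.2, ha⟩
  · rintro ⟨hz, hE⟩
    exact ⟨⟨z, hz⟩, hE, rfl⟩

theorem mem_regionOff_iff (n : ℕ) (z : Site 3) :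
    z ∈ regionOff n ↔ (0 ≤ z 0 ∧ z 0 ≤ ((4 * n : ℕ) : ℤ)) ∧ |z 1| ≤ ((2 * n : ℕ) : ℤ) ∧
      |z 2| ≤ ((2 * n : ℕ) : ℤ) := by
  rw [regionOff, mem_image_val_slabLift_iff]
  simp [sqBox]

theorem mem_columnOff_iff (n : ℕ) (z : Site 3) :
    z ∈ columnOff n ↔ (0 ≤ z 0 ∧ z 0 ≤ ((4 * n : ℕ) : ℤ)) ∧ |z 1| ≤ (n : ℤ) ∧ |z 2| ≤ (n : ℤ) := by
  rw [columnOff, mem_image_val_slabLift_iff]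
  simp [sqBox]

theorem mem_lateralOff_iff (n : ℕ) (z : Site 3) :
    z ∈ lateralOff n ↔ (0 ≤ z 0 ∧ z 0 ≤ ((4 * n : ℕ) : ℤ)) ∧
      max |z 1| |z 2| = ((2 * n : ℕ) : ℤ) := by
  rw [lateralOff, mem_image_val_slabLift_iff]
  simp [sqSphere]

/-! ### (2) The shift by `2n·e₀` -/

/-- The shift vector `2n·e₀`. -/
def v0 (n : ℕ) : Site 3 := Pi.single 0 (2 * (n : ℤ))

@[simp] theorem v0_apply_zero (n : ℕ) : v0 n 0 = 2 * (n : ℤ) := by simp [v0]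
@[simp] theorem v0_apply_one (n : ℕ) : v0 n 1 = 0 := by simp [v0]
@[simp] theorem v0_apply_two (n : ℕ) : v0 n 2 = 0 := by simp [v0]

/-- The shift `x ↦ x + 2n e₀` as an equivalence of `ℤ³`. -/
def eShift (n : ℕ) : Site 3 ≃ Site 3 := Site.shift (v0 n)

@[simp] theorem eShift_apply (n : ℕ) (x : Site 3) (i : Fin 3) : eShift n x i = x i + v0 n i := rfl

/-- Membership in `B(m) ⊆ ℤ³`, coordinate by coordinate. -/
theorem mem_box3_iff {m : ℕ} {x : Site 3} : x ∈ box 3 m ↔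
    (-(m : ℤ) ≤ x 0 ∧ x 0 ≤ m) ∧ (-(m : ℤ) ≤ x 1 ∧ x 1 ≤ m) ∧ (-(m : ℤ) ≤ x 2 ∧ x 2 ≤ m) := by
  rw [mem_box]
  constructor
  · intro h
    exact ⟨h 0, h 1, h 2⟩
  · rintro ⟨h0, h1, h2⟩ i
    fin_cases i
    · exact h0
    · exact h1
    · exact h2

theorem shift_mem_regionOff_iff (n : ℕ) (x : Site 3) : eShift n x ∈ regionOff n ↔ x ∈ box 3 (2 * n) := by
  rw [mem_regionOff_iff, mem_box3_iff]
  simp only [eShift_apply, v0_apply_zero, v0_apply_one, v0_apply_two, add_zero, abs_le]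
  push_cast
  omega

theorem shift_mem_columnOff_iff (n : ℕ) (x : Site 3) : eShift n x ∈ columnOff n ↔ x ∈ column0 n := by
  rw [mem_columnOff_iff, column0, Set.mem_setOf_eq, mem_box3_iff]
  simp only [eShift_apply, v0_apply_zero, v0_apply_one, v0_apply_two, add_zero, abs_le]
  push_cast
  omega

/-- `max a b = c` in linear form. -/
theorem max_eq_iff_linear {a b c : ℤ} : max a b = c ↔ (a ≤ c ∧ b ≤ c) ∧ (c ≤ a ∨ c ≤ b) := by
  rw [le_antisymm_iff, max_le_iff, le_max_iff]

theorem shift_mem_lateralOff_iff (n : ℕ) (y : Site 3) : eShift n y ∈ lateralOff n ↔ y ∈ lateral0 n := by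
  have h2n : (0 : ℤ) ≤ 2 * (n : ℤ) := by positivity
  rw [mem_lateralOff_iff, lateral0, Set.mem_setOf_eq, mem_box3_iff]
  push_cast
  simp only [eShift_apply, v0_apply_zero, v0_apply_one, v0_apply_two, add_zero,
    max_eq_iff_linear, abs_eq h2n, abs_le, le_abs]
  omega

/-- `shift '' B(2n) = regionOff n`. -/
theorem image_shift_box (n : ℕ) : eShift n '' (↑(box 3 (2 * n)) : Set (Site 3)) = regionOff n := by
  ext z
  rw [Equiv.image_eq_preimage_symm, Set.mem_preimage, Finset.mem_coe,
    ← shift_mem_regionOff_iff n ((eShift n).symm z), Equiv.apply_symm_apply]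

/-- The shift carries the centred curtain onto the offset curtain:
`shift⁻¹(curtainOff n) = curtain0 n` (as a preimage under relabelling). -/
theorem preimage_relabel_shift_curtainOff (n : ℕ) :
    BondConfig.relabel (sym2Equiv (eShift n)) ⁻¹' curtainOff n = curtain0 n := by
  ext ω
  simp only [Set.mem_preimage, curtainOff, curtain0, Set.mem_setOf_eq, not_iff_not]
  constructor
  · rintro ⟨x', hx', y', hy', h⟩
    refine ⟨(eShift n).symm x', ?_, (eShift n).symm y', ?_, ?_⟩
    · rw [← shift_mem_columnOff_iff, Equiv.apply_symm_apply]; exact hx'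
    · rw [← shift_mem_lateralOff_iff, Equiv.apply_symm_apply]; exact hy'
    · rw [← relabel_mem_openConnIn_iff (eShift n) ω (↑(box 3 (2 * n)) : Set (Site 3))
        ((eShift n).symm x') ((eShift n).symm y'), image_shift_box, Equiv.apply_symm_apply,
        Equiv.apply_symm_apply]
      exact h
  · rintro ⟨x, hx, y, hy, h⟩
    refine ⟨eShift n x, (shift_mem_columnOff_iff n x).2 hx, eShift n y,
      (shift_mem_lateralOff_iff n y).2 hy, ?_⟩
    rw [← image_shift_box n]
    exact (relabel_mem_openConnIn_iff (eShift n) ω _ x y).2 h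

/-! ### The restriction pulls NTW's event back to the offset curtain -/

theorem preimage_restrict_slabCross (n : ℕ) :
    restrictConfig (Subtype.val : slab 3 (4 * n) → Site 3) ⁻¹' slabCross (4 * n) n = (curtainOff n)ᶜ := by
  ext ω
  simp only [Set.mem_preimage, slabCross, slabConn, mem_openCrossing_iff, curtainOff, Set.mem_compl_iff,
    Set.mem_setOf_eq, not_not]
  constructor
  · rintro ⟨a, ha, b, hb, h⟩
    exact ⟨a.1, ⟨a, ha, rfl⟩, b.1, ⟨b, hb, rfl⟩,
      (restrictConfig_mem_openConnIn_iff (slab 3 (4 * n)) ω _ a b).1 h⟩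
  · rintro ⟨x, ⟨a, ha, rfl⟩, y, ⟨b, hb, rfl⟩, h⟩
    exact ⟨a, ha, b, hb, (restrictConfig_mem_openConnIn_iff (slab 3 (4 * n)) ω _ a b).2 h⟩

/-- The slab measure is the push-forward of the `ℤ³` measure under restriction. -/
theorem μS_eq_map (k : ℕ) (p : unitInterval) :
    μS k p = (μ p).map (restrictConfig (Subtype.val : slab 3 k → Site 3)) :=
  (bondPercolation_map_comap (zdGraph 3) (f := (Subtype.val : slab 3 k → Site 3))
    Subtype.val_injective p).symm

/-- **`stub_slabTransfer`, PROVED**: the `ℤ³`-probability of the centred curtain is the slab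
probability of NTW's blocking event `(B̄_n ↮ ∂B̄_{2n})` in `S_{4n}`. -/
theorem slabTransfer (p : unitInterval) (n : ℕ) :
    (μ p).real (curtain0 n) = (μS (4 * n) p).real (slabCross (4 * n) n)ᶜ := by
  rw [μS_eq_map, map_measureReal_apply (measurable_restrictConfig _) (measurableSet_slabCross _ _).compl,
    Set.preimage_compl, preimage_restrict_slabCross, compl_compl, ← preimage_relabel_shift_curtainOff n]
  exact bondPercolation_real_preimage_shift (v0 n) p (curtainOff n)

end Summit.CriticalPhenomena.PercolationContinuityZ3.Cruxes.SubpolynomialBlocking.SlabLadderTwoCurtains.TransferProof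

end
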